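import Summits.PneNP.PneNP.Cruxes.FoolingMeasure.NormalCycleSystems

/-!
# SymmetricReadout — crux-ideate r2 seat 1 g20 on `FoolingMeasure` (stmt-PneNP-19727)
Cards `matching-threshold-readout`, `one-step-clock-law`, `phase-cell-product` (Ideas/ in this crux dir).
§1 the READOUT IDENTITY (K); §2 symmetric duties, the matching-threshold duty, profile readout (K); §3 clock law and
phase relation (typed Props).  First lemma of §1: the READOUT IDENTITY.
For a normal cycle system `S` whose graph lies in a duty rectangle `dutyRect B Φ`, Bob's duty `Φ`
is forced to READ OUT, for every ruler `k` and every vertex `v`, whether the ruler edge `{v, succ_k v}`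
lies inside `B`:  `seamColour S k v ∈ Φ ↔ (v ∈ B ∧ succ_k v ∈ B)`.
(Only `seam_proper` is used — no rigidity, no vortex analysis, darkness not even needed.)
-/

namespace Summit.PneNP.PneNP.Cruxes.FoolingMeasure.IdeasR2s1g20

open Finset
open Summit.PneNP.PneNP.Cruxes.FoolingMeasure.IdeasR2g3
open Summit.PneNP.PneNP.Theorems.AeaCutRectanglesDutyRectangles (dutyRect mem_dutyRect map_mk_isDiag_iff)

variable {q t : ℕ}

/-- Under a seam colouring of a normal system the only monochromatic edge of the system is the seam edge. -/
theorem eq_seam_of_isDiag (S : CycleSystem q t) (hq : 1 ≤ q) (hN : S.Normal) (k : Fin t)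
    (v : Fin (3 * q + 1)) {e : Sym2 (Fin (3 * q + 1))} (he : e ∈ S.edges)
    (hd : (e.map (seamColour S k v)).IsDiag) : e = s(v, S.succ k v) := by
  classical
  simp only [CycleSystem.edges, mem_image, mem_univ, true_and] at he
  obtain ⟨⟨i, u⟩, rfl⟩ := he
  have h := (map_mk_isDiag_iff (seamColour S k v) u (S.succ i u)).1 hd
  by_cases hiu : i = k ∧ u = v
  · obtain ⟨rfl, rfl⟩ := hiu
    rfl
  · exact absurd h (seam_proper S hq hN k v i u hiu)

/-- **READOUT IDENTITY.**  If the graph of a normal system lies in the duty rectangle of `Φ` over the cut `B`,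
then membership of each of its `t·n` seam colourings in `Φ` is dictated: the seam colouring of ruler `k` at `v`
is in Bob's duty iff the seam edge `{v, succ_k v}` lies inside `B`. -/
theorem readout (S : CycleSystem q t) (hq : 1 ≤ q) (hN : S.Normal)
    {B : Finset (Fin (3 * q + 1))} {Φ : Set (Fin (3 * q + 1) → Fin 3)}
    (hG : S.edges ∈ dutyRect B Φ) (k : Fin t) (v : Fin (3 * q + 1)) :
    seamColour S k v ∈ Φ ↔ (v ∈ B ∧ S.succ k v ∈ B) := by
  classical
  have hG' := mem_dutyRect.1 hG
  constructor
  · intro hc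
    obtain ⟨e, he, hin, hd⟩ := hG'.2.1 _ hc
    have h := eq_seam_of_isDiag S hq hN k v he hd
    subst h
    exact ⟨hin v (Sym2.mem_mk_left _ _), hin _ (Sym2.mem_mk_right _ _)⟩
  · rintro ⟨hvB, hsB⟩
    by_contra hc
    obtain ⟨e, he, ⟨w, hw, hwB⟩, hd⟩ := hG'.2.2 _ hc
    have h := eq_seam_of_isDiag S hq hN k v he hd
    subst h
    rcases Sym2.mem_iff.1 hw with rfl | rfl
    · exact hwB hvB
    · exact hwB hsB

/-- The set of systems whose seam pattern over `B` is read out by `Φ` (the READOUT EVENT).  By `readout`,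
the duty rectangle of `Φ` (restricted to graphs of normal systems) is contained in it; the card's LADDER LEMMA
asserts that for near-balanced `B` its share among normal `t`-systems is at most `2^(-κ·t·n·(1-o(1)))`,
`κ = κ(|B|/n)` the independent-half exponent (`κ(1/2) = 1`, `κ(0.49) ≈ 0.878`). -/
def readoutEvent (B : Finset (Fin (3 * q + 1))) (Φ : Set (Fin (3 * q + 1) → Fin 3)) :
    Set (CycleSystem q t) :=
  {S | ∀ k : Fin t, ∀ v : Fin (3 * q + 1), seamColour S k v ∈ Φ ↔ (v ∈ B ∧ S.succ k v ∈ B)}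

theorem dutyRect_subset_readoutEvent (S : CycleSystem q t) (hq : 1 ≤ q) (hN : S.Normal)
    {B : Finset (Fin (3 * q + 1))} {Φ : Set (Fin (3 * q + 1) → Fin 3)}
    (hG : S.edges ∈ dutyRect B Φ) : S ∈ readoutEvent (t := t) B Φ :=
  fun k v => readout S hq hN hG k v

/-- LADDER LEMMA (the card's hardest stub, stated as a Prop; informal exponent `κ(β) = H(β) − (1−β)H(β/(1−β))`):
for every `κ' < κ(1/2 − ε)`, eventually in `q`, for every `t`, every cut `B` with `(1/2−ε)n ≤ |B| ≤ (1/2+ε)n`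
(`n = 3q+1`) and every duty `Φ`, the normal `t`-systems in the readout event are at most a `2^(−κ'·t·n)`
fraction of all normal `t`-systems. -/
def LadderLemma (ε κ' : ℝ) : Prop :=
  ∀ᶠ q : ℕ in Filter.atTop, ∀ t : ℕ, ∀ B : Finset (Fin (3 * q + 1)),
    (1 / 2 - ε) * ((3 * q + 1 : ℕ) : ℝ) ≤ B.card → (B.card : ℝ) ≤ (1 / 2 + ε) * ((3 * q + 1 : ℕ) : ℝ) →
    ∀ Φ : Set (Fin (3 * q + 1) → Fin 3),
      (Nat.card {S : CycleSystem q t // S.Normal ∧ S ∈ readoutEvent (t := t) B Φ} : ℝ) ≤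
        (2 : ℝ) ^ (-(κ' * t * ((3 * q + 1 : ℕ) : ℝ))) * Nat.card {S : CycleSystem q t // S.Normal}


/-! ### Session 2 — symmetric duties: the profile readout, the matching-threshold duty, the skew principle

Cards `matching-threshold-readout` (kill-side instrument) and `quadratic-skew-coupling` (construct-side fork).
A SYMMETRIC duty sees a colouring only through the multiset of its `B`-class sizes.  `profile_readout` (K): under a
symmetric duty, no colouring that Bob's side leaves alive may share the profile of a CLOSED seam colouring, and no
colouring that Alice's side leaves alive may share the profile of an OPEN seam colouring.  `BobHalf` (P): a perfect
matching inside `B` makes Bob's side kill the whole matching-threshold duty. -/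

section Symmetric

open Summit.PneNP.PneNP.Theorems.AeaCutRectanglesDutyRectangles (killSet bobSide aliceSide mem_bobSide mem_aliceSide)

variable {n : ℕ}

/-- The `B`-profile of a colouring: the number of vertices of `B` of colour `r`. -/
def profile (B : Finset (Fin n)) (c : Fin n → Fin 3) (r : Fin 3) : ℕ := (B.filter fun v => c v = r).card

/-- `c'` has the same `B`-profile as `c` up to a permutation of the colours. -/
def SameProfile (B : Finset (Fin n)) (c c' : Fin n → Fin 3) : Prop :=
  ∃ π : Equiv.Perm (Fin 3), ∀ r, profile B c' (π r) = profile B c r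

/-- A duty is SYMMETRIC over `B` if membership depends only on the multiset of `B`-class sizes. -/
def SymmetricDuty (B : Finset (Fin n)) (Φ : Set (Fin n → Fin 3)) : Prop :=
  ∀ c c' : Fin n → Fin 3, SameProfile B c c' → (c ∈ Φ ↔ c' ∈ Φ)

/-- The MATCHING-THRESHOLD duty: colourings with one colour class holding more than half of `B`. -/
def thresholdDuty (B : Finset (Fin n)) : Set (Fin n → Fin 3) := {c | ∃ r : Fin 3, B.card < 2 * profile B c r}

/-- `M` is a perfect matching of `B` inside the edge set `G`. -/
def IsPerfectMatchingOn (B : Finset (Fin n)) (G M : Finset (Sym2 (Fin n))) : Prop :=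
  M ⊆ G ∧ (∀ e ∈ M, ¬ e.IsDiag ∧ ∀ v ∈ e, v ∈ B) ∧ ∀ v ∈ B, ∃! e, e ∈ M ∧ v ∈ e

/-- BOB'S HALF (P; first stub of `matching-threshold-readout`): a perfect matching of `B` inside `G` forces every
colouring not killed by Bob's side to have all `B`-classes of size ≤ `|B|/2`, so Bob's side kills `thresholdDuty B`. -/
def BobHalf (n : ℕ) : Prop :=
  ∀ (B : Finset (Fin n)) (G M : Finset (Sym2 (Fin n))), IsPerfectMatchingOn B G M →
    ∀ c : Fin n → Fin 3, c ∉ killSet (bobSide B G) → ∀ r : Fin 3, 2 * profile B c r ≤ B.card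

end Symmetric

open Summit.PneNP.PneNP.Theorems.AeaCutRectanglesDutyRectangles (killSet bobSide aliceSide mem_bobSide mem_aliceSide)

/-- **PROFILE READOUT, closed seams (K).**  Normal system in the duty rectangle of a SYMMETRIC duty over `B`:
every colouring with the profile of a closed seam colouring (seam edge inside `B`) is killed by Bob's side —
equivalently, no proper colouring of `S[B]` has that profile. -/
theorem profile_readout_closed (S : CycleSystem q t) (hq : 1 ≤ q) (hN : S.Normal)
    {B : Finset (Fin (3 * q + 1))} {Φ : Set (Fin (3 * q + 1) → Fin 3)} (hΦ : SymmetricDuty B Φ)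
    (hG : S.edges ∈ dutyRect B Φ) (k : Fin t) (v : Fin (3 * q + 1)) (hv : v ∈ B) (hsv : S.succ k v ∈ B)
    (c' : Fin (3 * q + 1) → Fin 3) (hc' : SameProfile B (seamColour S k v) c') :
    c' ∈ killSet (bobSide B S.edges) := by
  classical
  have h1 : seamColour S k v ∈ Φ := (readout S hq hN hG k v).2 ⟨hv, hsv⟩
  have h2 : c' ∈ Φ := (hΦ _ _ hc').1 h1
  obtain ⟨e, he, hin, hd⟩ := (mem_dutyRect.1 hG).2.1 c' h2
  exact ⟨e, mem_bobSide.2 ⟨he, hin⟩, (mem_dutyRect.1 hG).1 e he, hd⟩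

/-- **PROFILE READOUT, open seams (K).**  Dually, every colouring with the profile of an OPEN seam colouring
(seam edge meeting `V ∖ B`) is killed by Alice's side — no proper colouring of `S − E(S[B])` has that profile. -/
theorem profile_readout_open (S : CycleSystem q t) (hq : 1 ≤ q) (hN : S.Normal)
    {B : Finset (Fin (3 * q + 1))} {Φ : Set (Fin (3 * q + 1) → Fin 3)} (hΦ : SymmetricDuty B Φ)
    (hG : S.edges ∈ dutyRect B Φ) (k : Fin t) (v : Fin (3 * q + 1)) (hopen : ¬ (v ∈ B ∧ S.succ k v ∈ B))
    (c' : Fin (3 * q + 1) → Fin 3) (hc' : SameProfile B (seamColour S k v) c') :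
    c' ∈ killSet (aliceSide B S.edges) := by
  classical
  have h1 : seamColour S k v ∉ Φ := fun h => hopen ((readout S hq hN hG k v).1 h)
  have h2 : c' ∉ Φ := fun h => h1 ((hΦ _ _ hc').2 h)
  obtain ⟨e, he, hout, hd⟩ := (mem_dutyRect.1 hG).2.2 c' h2
  exact ⟨e, mem_aliceSide.2 ⟨he, hout⟩, (mem_dutyRect.1 hG).1 e he, hd⟩

/-- MATCHING-THRESHOLD CAPTURE CRITERION (H: modulo rigidity of `S − E(S[B])` and absence of flip sites; P for the
seam part): a normal system with a perfect matching of `B` among its inside edges lies in `dutyRect B (thresholdDuty B)`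
as soon as every closed seam colouring puts `|B|/2 + 1` vertices of `B` into the seam's own class and every other
proper colouring of `S − E(S[B])` does too.  Stated here only through its checkable seam consequence. -/
def SeamHalfSkewed (S : CycleSystem q t) (B : Finset (Fin (3 * q + 1))) : Prop :=
  ∀ k : Fin t, ∀ v : Fin (3 * q + 1), v ∈ B → S.succ k v ∈ B →
    B.card < 2 * profile B (seamColour S k v) (seamColour S k v v)

theorem seamHalfSkewed_of_capture (S : CycleSystem q t) (hq : 1 ≤ q) (hN : S.Normal)
    {B : Finset (Fin (3 * q + 1))} (hBob : ∀ c : Fin (3 * q + 1) → Fin 3,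
      c ∉ killSet (bobSide B S.edges) → ∀ r : Fin 3, 2 * profile B c r ≤ B.card)
    (hG : S.edges ∈ dutyRect B (thresholdDuty B)) :
    ∀ k : Fin t, ∀ v : Fin (3 * q + 1), v ∈ B → S.succ k v ∈ B →
      ∃ r : Fin 3, B.card < 2 * profile B (seamColour S k v) r := by
  intro k v hv hsv
  exact (readout S hq hN hG k v).2 ⟨hv, hsv⟩


/-! ### Session 2 (cont.) — the one-step clock law and the phase relation between frames -/

/-- **ALICE-LIVE ⟹ DUTY (K).**  In a duty rectangle every colouring that Alice's side leaves alive lies in Bob's duty.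
With `Φ = thresholdDuty B` this is the SLACK LAW of card `one-step-clock-law`: if a closed seam colouring has its
majority class of size exactly `|B|/2 + 1` and ONE majority vertex of `B` can be recoloured without creating a
monochromatic edge meeting `V \ B`, the recoloured colouring is Alice-live with all classes `≤ |B|/2`, so the member
is NOT captured. -/
theorem aliceLive_mem_duty {n : ℕ} {B : Finset (Fin n)} {Φ : Set (Fin n → Fin 3)} {G : Finset (Sym2 (Fin n))}
    (hG : G ∈ dutyRect B Φ) (c : Fin n → Fin 3) (hc : c ∉ killSet (aliceSide B G)) : c ∈ Φ := by
  classical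
  by_contra h
  obtain ⟨e, he, hout, hd⟩ := (mem_dutyRect.1 hG).2.2 c h
  exact hc ⟨e, mem_aliceSide.2 ⟨he, hout⟩, (mem_dutyRect.1 hG).1 e he, hd⟩

/-- Dually (K): every colouring that Bob's side leaves alive lies OUTSIDE Bob's duty. -/
theorem bobLive_not_mem_duty {n : ℕ} {B : Finset (Fin n)} {Φ : Set (Fin n → Fin 3)} {G : Finset (Sym2 (Fin n))}
    (hG : G ∈ dutyRect B Φ) (c : Fin n → Fin 3) (hc : c ∉ killSet (bobSide B G)) : c ∉ Φ := by
  classical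
  intro h
  obtain ⟨e, he, hin, hd⟩ := (mem_dutyRect.1 hG).2.1 c h
  exact hc ⟨e, mem_bobSide.2 ⟨he, hin⟩, (mem_dutyRect.1 hG).1 e he, hd⟩

/-- ONE-STEP CLOCK LAW (P, from `seamColour_shift`: moving the seam base from `a` to `succ_k a` relabels every colour
by `+2` except at the single vertex `succ_k a`): consecutive seam colourings of a ruler have `B`-profiles that agree,
up to a permutation of the colours, except that at most one vertex of `B` changes class.  Hence along a ruler the
profile multiset performs a walk with unit steps — a threshold can only be crossed by exactly one. -/
def OneStepLaw (q t : ℕ) : Prop :=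
  ∀ (S : CycleSystem q t) (k : Fin t) (a : Fin (3 * q + 1)) (B : Finset (Fin (3 * q + 1))),
    ∃ π : Equiv.Perm (Fin 3), ∀ r : Fin 3,
      ((profile B (seamColour S k (S.succ k a)) (π r) : ℤ) - profile B (seamColour S k a) r).natAbs ≤ 1

/-- PHASE STEP (P, from `Normal` and `val_pos_succ`): read along ruler `k`, the frame-`k'` residue of consecutive vertices
advances by `2` at a non-wrapping step and by `1` at a wrapping step (`n = 3q+1 ≡ 1 mod 3`).  Consequently
`res_{k'}(v_i) = res_{k'}(v_0) + 2·i − W_i (mod 3)` with `W_i` the number of `k'`-wraps among the first `i` steps of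
ruler `k`: frame `k'` is the affine image of frame `k` twisted by the WRAP PHASE — the lever of card
`phase-cell-product`. -/
def PhaseStep (q t : ℕ) : Prop :=
  ∀ (S : CycleSystem q t), S.Normal → ∀ k k' : Fin t, k ≠ k' → ∀ v : Fin (3 * q + 1),
    ((S.pos k' v).val < (S.pos k' (S.succ k v)).val ∧
        (S.pos k' (S.succ k v)).val % 3 = ((S.pos k' v).val + 2) % 3) ∨
    ((S.pos k' (S.succ k v)).val < (S.pos k' v).val ∧
        (S.pos k' (S.succ k v)).val % 3 = ((S.pos k' v).val + 1) % 3)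

/-- The (residue, phase) CELL of a vertex relative to the ordered ruler pair `(k, k')`: its frame-`k` residue and its
frame-`k'` residue (the phase is recovered as `2·res_k − res_{k'} + const`).  Joint `B`-profiles in the two frames are
the row and twisted-diagonal margins of the 3 × 3 table `|B ∩ cell|`. -/
def cell (S : CycleSystem q t) (k k' : Fin t) (v : Fin (3 * q + 1)) : Fin 3 × Fin 3 :=
  (⟨(S.pos k v).val % 3, Nat.mod_lt _ (by norm_num)⟩, ⟨(S.pos k' v).val % 3, Nat.mod_lt _ (by norm_num)⟩)

/-- PHASE EQUIDISTRIBUTION at scale `δ` (the checkable hypothesis of card `phase-cell-product`): every one of the nine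
(residue, residue) cells of every ordered ruler pair holds between `(1/9 − δ)n` and `(1/9 + δ)n` vertices. -/
def PhaseEquidistributed (S : CycleSystem q t) (δ : ℝ) : Prop :=
  ∀ k k' : Fin t, k ≠ k' → ∀ p : Fin 3 × Fin 3,
    |(((Finset.univ.filter fun v => cell S k k' v = p).card : ℝ)) - ((3 * q + 1 : ℕ) : ℝ) / 9| ≤ δ * ((3 * q + 1 : ℕ) : ℝ)

end Summit.PneNP.PneNP.Cruxes.FoolingMeasure.IdeasR2s1g20
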